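/-
Copyright (c) 2026 the pub-hodgecm-mathlib formalisation cell (harness21).  Prover seat hodgecm-mathlib-K2Liu-p09 (g5): Track B «K2-LIT»,
hLiu418 = stmt-HodgeConjecture-24832; LEAD F0P6-plan (g12) RULINGS M-156m∕M-156o «A7 = GK COCYCLE ROAD», file B4c-2 (algebra for B4-concrete).
-/
import Summits.HodgeConjecture.HodgeConjecture.Theorems.K2LiuDoubledUTwoTwoLevi   -- ★ B1a-3 (K2Liu-p03): `leviElt`, `leviElt_mul`, `leviElt_eq_torusElt∕weylOne`
import HarnessLib

/-!
# Crux `HLiu418`, road `K2_Liu`, organ A7-reg (GK cocycle road), file B4c-2: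
# THE RANK-ONE `SL₂` RELATION FOR THE SHORT SIMPLE ROOT `α₁ = e₁ − e₂` OF `U(J₄)`, FULL AND PER IDEMPOTENT (split places)

Cell `hodgecm-mathlib`, crux item hLiu418 = `stmt-HodgeConjecture-24832`; squad K2 ∕ K2Liu; prover K2Liu-p09 (g5).
THEOREMS ONLY (no `def`, no instance, no notation, no named-fact hypothesis, no `sorry`); lane `--supports stmt-HodgeConjecture-24832`
(count-neutral helper).  Pure algebra over a commutative ring `R` with an involution `σ`, on K2Liu-p03 (g6)'s ★ Levi letters (RULING M-156o (c)).

WHY PER IDEMPOTENT.  At a place `v` of `F` SPLIT in `E` the coefficient ring of the transported frame is `R = E ⊗ F_v = E_{w₁} × E_{w₂}`, the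
variable `z ∈ R` of the letter `u_{e₁−e₂}(z)` is a PAIR of local-field variables, and the middle factor `A₁` of the cocycle `M = A₂ A₁ A₂` is the
composite of ONE rank-one step per place `w ∣ v` (matching ★ T1 `lEN = Π_{w∣v} L_{E_w}` factor by factor).  The step at `w` uses the
PARTIAL Weyl letter `P_ε := m(ε W + (1−ε) 1)` of the idempotent `ε = ε_w` of the `w`-factor (at a non-split place `ε = 1`, `P_1 = w₁`).
Everything is a LEVI letter `m(A) = leviElt A`, so all identities are `2 × 2` identities pushed through ★ `leviElt_mul` — the `σ`-twisted lower block
of `U(J₄)` never has to be touched.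

* §1 `leviElt_eq_uMinus` — `u_{e₁−e₂}(z) = m(1 z; 0 1)`; the idempotent combination algebra `(εM + (1−ε)M′)(εN + (1−ε)N′) = ε MN + (1−ε) M′N′`
  and the `2 × 2` identity `W U(t) = U(t⁻¹) · diag(−t⁻¹, t) · (W U(t⁻¹) W)`.
* §2 **`weylOne_mul_uMinus_eq`** (full): `w₁ · u(t) = u(t⁻¹) · t(−t⁻¹, t) · (w₁ u(t⁻¹) w₁)` for `t ∈ Rˣ`.
* §3 **`leviElt_partialWeyl_mul_uMinus_eq`** (per idempotent `ε`, `ε² = ε`): `P_ε · u(ε t) = u(ε t⁻¹) · t(a, b) · (P_ε u(ε t⁻¹) P_ε)` with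
  `a = 1 − ε − ε t⁻¹`, `b = 1 − ε + ε t` (units: inverses `1 − ε − ε t`, `1 − ε + ε t⁻¹`).
* §4 orthogonal idempotents (`ε ε′ = 0`): `P_ε` commutes with `u(ε′ z)` and `P_ε P_{ε′} = P_{ε+ε′}` — so `w₁ = Π_w P_{ε_w}` and the `A₁`-step splits.
HONEST LABEL.  `HC_CM` is proved only modulo the 7 printed citations (2 remaining named inputs: hLiu418 = `stmt-HodgeConjecture-24832`,
h413 = `stmt-HodgeConjecture-24833`) until rung 0 closes.

## References
* [Casselman1980] W. Casselman, *The unramified principal series of p-adic groups I*, Compositio Math. 40 (1980), §3 (rank-one reduction).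
* [HarrisKudlaSweet1996] M. Harris, S. Kudla, W. J. Sweet, J. AMS 9 (1996), §1 (1.11) (Siegel Levi `m(A)`), §6 (6.16) (`L_E = L_F L_F^η` at split places).
* [Tate1950] J. Tate (1950), §2.5 (places of `E` over a split place of `F`).
-/

set_option autoImplicit false
set_option linter.dupNamespace false -- the mandated namespace repeats `HodgeConjecture.HodgeConjecture`

noncomputable section

open Matrix
open Literature.NumberTheory.Automorphic
open Summit.HodgeConjecture.HodgeConjecture.Cruxes.HLiu418.K2LiuDoubledUTwoTwoBorelFrame
open Summit.HodgeConjecture.HodgeConjecture.Cruxes.HLiu418.K2LiuDoubledUTwoTwoWeylCocycle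
open Summit.HodgeConjecture.HodgeConjecture.Cruxes.HLiu418.K2LiuDoubledUTwoTwoLevi

namespace Summit.HodgeConjecture.HodgeConjecture.Cruxes.HLiu418.K2LiuDoubledUTwoTwoRankOneRelationsLevi

variable {R : Type*} [CommRing R] {σ : R →+* R}

/-! ## §1 `u_{e₁−e₂}` is a Levi letter; idempotent combinations; the `2 × 2` `SL₂` identity -/

/-- **`u_{e₁−e₂}(z) = m(1 z; 0 1)`** for any `U ∈ GL₂(R)` with matrix `(1 z; 0 1)`. [cite: HarrisKudlaSweet1996, §1 (1.11)] -/
theorem leviElt_eq_uMinus (hσ : ∀ x, σ (σ x) = x) (z : R) (U : GL (Fin 2) R) (hU : (U : Matrix (Fin 2) (Fin 2) R) = !![1, z; 0, 1]) :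
    leviElt R σ hσ U = uMinus R σ hσ z := by
  have hUi : (U : Matrix (Fin 2) (Fin 2) R)⁻¹ = !![1, -z; 0, 1] := by
    rw [hU]
    refine Matrix.inv_eq_left_inv ?_
    ext i j; fin_cases i <;> fin_cases j <;> simp [Matrix.mul_apply, Fin.sum_univ_two]
  apply ext_of_coe
  rw [coe_leviElt, coe_uMinus]
  unfold leviM
  rw [hUi, hU]
  ext i j
  fin_cases i <;> fin_cases j <;> simp [uMinusM]

/-- **idempotent combinations multiply componentwise**: `(εM + (1−ε)M′)(εN + (1−ε)N′) = ε MN + (1−ε) M′N′` for `ε² = ε`. [cite: Tate1950, §2.5] -/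
theorem comb_mul_comb {n : Type*} [Fintype n] [DecidableEq n] {ε : R} (hε : ε * ε = ε) (M M' N N' : Matrix n n R) :
    (ε • M + (1 - ε) • M') * (ε • N + (1 - ε) • N') = ε • (M * N) + (1 - ε) • (M' * N') := by
  have h1 : ε * (1 - ε) = 0 := by rw [mul_sub, mul_one, hε, sub_self]
  have h2 : (1 - ε) * (1 - ε) = 1 - ε := by rw [sub_mul, one_mul, mul_sub, mul_one, hε, sub_self, sub_zero]
  rw [Matrix.add_mul, Matrix.mul_add, Matrix.mul_add, smul_mul_smul, smul_mul_smul, smul_mul_smul, smul_mul_smul, hε, h1,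
    mul_comm (1 - ε) ε, h1, h2, zero_smul, zero_smul, add_zero, zero_add]

/-- **the `2 × 2` `SL₂` identity** `W · U(t) = U(t⁻¹) · diag(−t⁻¹, t) · (W · U(t⁻¹) · W)`, `W = antidiag(1,1)`, `U(t) = (1 t; 0 1)`, `t` a unit.
[cite: Casselman1980, §3] -/
theorem antidiag_mul_upper_eq (t : Rˣ) :
    (!![0, 1; 1, 0] : Matrix (Fin 2) (Fin 2) R) * !![1, (t : R); 0, 1] =
      !![1, ((t⁻¹ : Rˣ) : R); 0, 1] * !![-((t⁻¹ : Rˣ) : R), 0; 0, (t : R)] *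
        ((!![0, 1; 1, 0] : Matrix (Fin 2) (Fin 2) R) * !![1, ((t⁻¹ : Rˣ) : R); 0, 1] * !![0, 1; 1, 0]) := by
  ext i j
  fin_cases i <;> fin_cases j <;> simp [Matrix.mul_apply, Fin.sum_univ_two, Units.inv_mul, Units.mul_inv]

/-! ## §2 The full `SL₂` relation of `α₁` (non-split places) -/

/-- **THE `SL₂` RELATION FOR `α₁`**: `w₁ · u_{e₁−e₂}(t) = u_{e₁−e₂}(t⁻¹) · t(−t⁻¹, t) · (w₁ · u_{e₁−e₂}(t⁻¹) · w₁)` for `t ∈ Rˣ` — the `2 × 2` identity of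
§1 pushed through `m = leviElt` (★ `leviElt_mul`, ★ `leviElt_eq_weylOne`, ★ `leviElt_eq_torusElt`, `leviElt_eq_uMinus`).
[cite: Casselman1980, §3] [cite: HarrisKudlaSweet1996, §1 (1.11)] -/
theorem weylOne_mul_uMinus_eq (hσ : ∀ x, σ (σ x) = x) (t : Rˣ) :
    weylOne R σ * uMinus R σ hσ (t : R) =
      uMinus R σ hσ ((t⁻¹ : Rˣ) : R) * torusElt R σ hσ (-t⁻¹) t * (weylOne R σ * uMinus R σ hσ ((t⁻¹ : Rˣ) : R) * weylOne R σ) := by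
  -- the five `GL₂` letters
  let Wu : GL (Fin 2) R := ⟨!![0, 1; 1, 0], !![0, 1; 1, 0],
    by ext i j; fin_cases i <;> fin_cases j <;> simp [Matrix.mul_apply, Fin.sum_univ_two],
    by ext i j; fin_cases i <;> fin_cases j <;> simp [Matrix.mul_apply, Fin.sum_univ_two]⟩
  let Ut : GL (Fin 2) R := ⟨!![1, (t : R); 0, 1], !![1, -(t : R); 0, 1],
    by ext i j; fin_cases i <;> fin_cases j <;> simp [Matrix.mul_apply, Fin.sum_univ_two],
    by ext i j; fin_cases i <;> fin_cases j <;> simp [Matrix.mul_apply, Fin.sum_univ_two]⟩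
  let Us : GL (Fin 2) R := ⟨!![1, ((t⁻¹ : Rˣ) : R); 0, 1], !![1, -((t⁻¹ : Rˣ) : R); 0, 1],
    by ext i j; fin_cases i <;> fin_cases j <;> simp [Matrix.mul_apply, Fin.sum_univ_two],
    by ext i j; fin_cases i <;> fin_cases j <;> simp [Matrix.mul_apply, Fin.sum_univ_two]⟩
  let D : GL (Fin 2) R := ⟨!![((-t⁻¹ : Rˣ) : R), 0; 0, (t : R)], !![(((-t⁻¹)⁻¹ : Rˣ) : R), 0; 0, ((t⁻¹ : Rˣ) : R)],
    by ext i j; fin_cases i <;> fin_cases j <;> simp [Matrix.mul_apply, Fin.sum_univ_two, Units.mul_inv],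
    by ext i j; fin_cases i <;> fin_cases j <;> simp [Matrix.mul_apply, Fin.sum_univ_two, Units.inv_mul]⟩
  have hGL : Wu * Ut = Us * D * (Wu * Us * Wu) := by
    refine Units.ext ?_
    simp only [Units.val_mul]
    show (!![0, 1; 1, 0] : Matrix (Fin 2) (Fin 2) R) * !![1, (t : R); 0, 1] =
      !![1, ((t⁻¹ : Rˣ) : R); 0, 1] * !![((-t⁻¹ : Rˣ) : R), 0; 0, (t : R)] *
        ((!![0, 1; 1, 0] : Matrix (Fin 2) (Fin 2) R) * !![1, ((t⁻¹ : Rˣ) : R); 0, 1] * !![0, 1; 1, 0])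
    rw [Units.val_neg]
    exact antidiag_mul_upper_eq t
  rw [← leviElt_eq_weylOne (R := R) (σ := σ) hσ Wu rfl, ← leviElt_eq_uMinus hσ (t : R) Ut rfl, ← leviElt_eq_uMinus hσ _ Us rfl,
    ← leviElt_eq_torusElt (R := R) (σ := σ) hσ (-t⁻¹) t D rfl, leviElt_mul, leviElt_mul, leviElt_mul, leviElt_mul, leviElt_mul, hGL]

/-! ## §3 The per-idempotent `SL₂` relation of `α₁` (the partial Weyl letter `P_ε = m(εW + (1−ε)1)`) -/

/-- **THE `SL₂` RELATION FOR `α₁` AT AN IDEMPOTENT `ε`** (`ε² = ε`): with `P_ε = m(A)`, `A = (1−ε ε; ε 1−ε) = εW + (1−ε)·1`, and units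
`a = 1 − ε − ε t⁻¹`, `b = 1 − ε + ε t`:
`P_ε · u_{e₁−e₂}(ε t) = u_{e₁−e₂}(ε t⁻¹) · t(a, b) · (P_ε · u_{e₁−e₂}(ε t⁻¹) · P_ε)`
— the `ε`-component is the `SL₂` identity, the `(1−ε)`-component is `1 = 1` (`comb_mul_comb`).  At `ε = 1` this is `weylOne_mul_uMinus_eq`; at a
split place with `ε = ε_w` it is the rank-one relation of the `w`-th factor of the `A₁`-step. [cite: Casselman1980, §3] [cite: HarrisKudlaSweet1996, §6 (6.16)] -/
theorem leviElt_partialWeyl_mul_uMinus_eq (hσ : ∀ x, σ (σ x) = x) {ε : R} (hε : ε * ε = ε) (t : Rˣ)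
    (A : GL (Fin 2) R) (hA : (A : Matrix (Fin 2) (Fin 2) R) = !![1 - ε, ε; ε, 1 - ε])
    (a b : Rˣ) (ha : (a : R) = 1 - ε - ε * ((t⁻¹ : Rˣ) : R)) (hb : (b : R) = 1 - ε + ε * (t : R)) :
    leviElt R σ hσ A * uMinus R σ hσ (ε * (t : R)) =
      uMinus R σ hσ (ε * ((t⁻¹ : Rˣ) : R)) * torusElt R σ hσ a b *
        (leviElt R σ hσ A * uMinus R σ hσ (ε * ((t⁻¹ : Rˣ) : R)) * leviElt R σ hσ A) := by
  -- the `GL₂` letters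
  let Ut : GL (Fin 2) R := ⟨!![1, ε * (t : R); 0, 1], !![1, -(ε * (t : R)); 0, 1],
    by ext i j; fin_cases i <;> fin_cases j <;> simp [Matrix.mul_apply, Fin.sum_univ_two],
    by ext i j; fin_cases i <;> fin_cases j <;> simp [Matrix.mul_apply, Fin.sum_univ_two]⟩
  let Us : GL (Fin 2) R := ⟨!![1, ε * ((t⁻¹ : Rˣ) : R); 0, 1], !![1, -(ε * ((t⁻¹ : Rˣ) : R)); 0, 1],
    by ext i j; fin_cases i <;> fin_cases j <;> simp [Matrix.mul_apply, Fin.sum_univ_two],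
    by ext i j; fin_cases i <;> fin_cases j <;> simp [Matrix.mul_apply, Fin.sum_univ_two]⟩
  let D : GL (Fin 2) R := ⟨!![(a : R), 0; 0, (b : R)], !![((a⁻¹ : Rˣ) : R), 0; 0, ((b⁻¹ : Rˣ) : R)],
    by ext i j; fin_cases i <;> fin_cases j <;> simp [Matrix.mul_apply, Fin.sum_univ_two, Units.mul_inv],
    by ext i j; fin_cases i <;> fin_cases j <;> simp [Matrix.mul_apply, Fin.sum_univ_two, Units.inv_mul]⟩
  -- every letter is an idempotent combination
  have hAc : (A : Matrix (Fin 2) (Fin 2) R) = ε • !![0, 1; 1, 0] + (1 - ε) • (1 : Matrix (Fin 2) (Fin 2) R) := by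
    rw [hA]; ext i j; fin_cases i <;> fin_cases j <;> simp
  have hUtc : (Ut : Matrix (Fin 2) (Fin 2) R) = ε • !![1, (t : R); 0, 1] + (1 - ε) • (1 : Matrix (Fin 2) (Fin 2) R) := by
    ext i j; fin_cases i <;> fin_cases j <;> simp [Ut]
  have hUsc : (Us : Matrix (Fin 2) (Fin 2) R) = ε • !![1, ((t⁻¹ : Rˣ) : R); 0, 1] + (1 - ε) • (1 : Matrix (Fin 2) (Fin 2) R) := by
    ext i j; fin_cases i <;> fin_cases j <;> simp [Us]
  have hDc : (D : Matrix (Fin 2) (Fin 2) R) = ε • !![-((t⁻¹ : Rˣ) : R), 0; 0, (t : R)] + (1 - ε) • (1 : Matrix (Fin 2) (Fin 2) R) := by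
    ext i j; fin_cases i <;> fin_cases j <;> simp [D, ha, hb] <;> ring
  have hGL : A * Ut = Us * D * (A * Us * A) := by
    refine Units.ext ?_
    simp only [Units.val_mul]
    rw [hAc, hUtc, hUsc, hDc]
    simp only [comb_mul_comb hε, Matrix.one_mul]
    rw [antidiag_mul_upper_eq t]
  rw [← leviElt_eq_uMinus hσ _ Ut rfl, ← leviElt_eq_uMinus hσ _ Us rfl, ← leviElt_eq_torusElt (R := R) (σ := σ) hσ a b D rfl,
    leviElt_mul, leviElt_mul, leviElt_mul, leviElt_mul, leviElt_mul, hGL]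

/-! ## §4 Orthogonal idempotents: the partial letters of distinct places commute and multiply -/

/-- **`P_ε` commutes with `u_{e₁−e₂}(ε′ z)` when `ε ε′ = 0`** (the partial Weyl letter of one place does not see the root variable of the other).
[cite: Tate1950, §2.5] [cite: HarrisKudlaSweet1996, §6 (6.16)] -/
theorem leviElt_partialWeyl_mul_uMinus_comm (hσ : ∀ x, σ (σ x) = x) {ε ε' : R} (hεε' : ε * ε' = 0) (z : R)
    (A : GL (Fin 2) R) (hA : (A : Matrix (Fin 2) (Fin 2) R) = !![1 - ε, ε; ε, 1 - ε]) :
    leviElt R σ hσ A * uMinus R σ hσ (ε' * z) = uMinus R σ hσ (ε' * z) * leviElt R σ hσ A := by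
  let U : GL (Fin 2) R := ⟨!![1, ε' * z; 0, 1], !![1, -(ε' * z); 0, 1],
    by ext i j; fin_cases i <;> fin_cases j <;> simp [Matrix.mul_apply, Fin.sum_univ_two],
    by ext i j; fin_cases i <;> fin_cases j <;> simp [Matrix.mul_apply, Fin.sum_univ_two]⟩
  have hGL : A * U = U * A := by
    refine Units.ext ?_
    simp only [Units.val_mul]
    rw [hA]
    ext i j
    fin_cases i <;> fin_cases j <;> simp [U, Matrix.mul_apply, Fin.sum_univ_two] <;>
      first | (linear_combination (0 : R) * hεε') | (linear_combination z * hεε')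
  rw [← leviElt_eq_uMinus hσ _ U rfl, leviElt_mul, leviElt_mul, hGL]

/-- **`P_ε · P_{ε′} = P_{ε+ε′}` when `ε ε′ = 0`** (so at a split place `P_{ε_{w₁}} P_{ε_{w₂}} = P_1 = w₁` by ★ `leviElt_eq_weylOne`).
[cite: Tate1950, §2.5] [cite: Casselman1980, §3] -/
theorem leviElt_partialWeyl_mul_partialWeyl (hσ : ∀ x, σ (σ x) = x) {ε ε' : R} (hεε' : ε * ε' = 0)
    (A B C : GL (Fin 2) R) (hA : (A : Matrix (Fin 2) (Fin 2) R) = !![1 - ε, ε; ε, 1 - ε])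
    (hB : (B : Matrix (Fin 2) (Fin 2) R) = !![1 - ε', ε'; ε', 1 - ε'])
    (hC : (C : Matrix (Fin 2) (Fin 2) R) = !![1 - (ε + ε'), ε + ε'; ε + ε', 1 - (ε + ε')]) :
    leviElt R σ hσ A * leviElt R σ hσ B = leviElt R σ hσ C := by
  have hGL : A * B = C := by
    refine Units.ext ?_
    simp only [Units.val_mul]
    rw [hA, hB, hC]
    ext i j
    fin_cases i <;> fin_cases j <;> simp [Matrix.mul_apply, Fin.sum_univ_two] <;>
      first | (linear_combination (0 : R) * hεε') | (linear_combination (2 : R) * hεε') | (linear_combination (-2 : R) * hεε')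
  rw [leviElt_mul, hGL]

end Summit.HodgeConjecture.HodgeConjecture.Cruxes.HLiu418.K2LiuDoubledUTwoTwoRankOneRelationsLevi

end
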